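import Summits.Ventures.YMGap.RobustBall.CentreTubeTierOne
import Summits.Ventures.YMGap.RobustBall.StringTensionCentreBlind
import HarnessLib

/-!
# Robust ball (Y2) — STRING TENSION ON THE TIER-1 BALL AROUND EVERY CENTRE-BLIND ACTION: the infinite-volume form of
# `AreaLawCentreTubeFR`

HONEST FRAMING: venture file of the cell `pub-ymgap` (QuantumFields programme), track ROBUST-BALL / DS seat ds-4 (g8).
Strong-coupling LATTICE statements; centre-projected `ℤ_N` flux picture; nothing about the continuum, a spectral mass gap, or Clay.

WHAT.  `CentreTubeTierOne` proves `AreaLawCentreTubeFR N d β ε₀ ε₁ r` (`N ≥ 2`, `2(d−1)N|β| + K(d,r) ε₀ < 1`): ONE pair `(C, c)` bounds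
`|⟨W_{R×T}⟩_{β, W_b + W, L}| ≤ C^{2(R+T)} e^{−cRT}` for EVERY torus, EVERY twist-blind `W_b` (any size, any range) and EVERY member `W` of the tier-1 ball
`ClusterDomainFR ε₀ ε₁ r`.  As in `StringTensionCentreBlind` / `StringTensionCentreTube` (schema = rb-p2's `hasAreaLawWith_of_torusBound`), the bound
passes to every INFINITE-VOLUME LIMIT STATE of every family `𝓦` that is eventually of the form `W_b + W`:
* `hasAreaLawWith_centreTubeFR` / `stringTension_centreTubeFR` — `HasAreaLawWith μ χ_N C c`, `HasAreaLawState`, `σ ≥ c` WHENEVER the string tension exists,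
  `IsConfining` given existence;
* `su2_stringTension_centreTubeFR_dim4_range1` — SU(2), `d = 4`, range `1`.
WHAT IS NOT CLAIMED.  EXISTENCE of the string tension of a limit state; crude counting constant `K(d,r)`; window smaller than tier 1's; T15's
unbounded-range loop terms outside.

References (mechanism, AS PRINTED): J. Fröhlich, Phys. Lett. B 83 (1979) 195–198 [Frohlich1979ZN]; G. Mack, V. B. Petkova, Ann. Phys. 123 (1979) 442–467
[MackPetkova1979]; B. Durhuus, J. Fröhlich, Comm. Math. Phys. 75 (1980) 103; E. Seiler, LNP 159 (1982) §2.
-/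

noncomputable section

open MeasureTheory Filter Topology
open Literature.MathematicalPhysics.QuantumLattice
open Literature.MathematicalPhysics.QuantumFieldTheory hiding ZdEdge Site
open Literature.Barriers.QuantumFields (suFundStringTension suFundStringTension_def)

namespace Summit.Ventures.YMGap.RobustBall

variable {d L N : ℕ}

/-- **TIER-1 BALL AROUND THE CENTRE-BLIND SUBSPACE ⇒ `ℤ^d` AREA LAW OF EVERY LIMIT STATE, SAME CONSTANTS** (`d ≥ 2`): under
`AreaLawCentreTubeFR N d β ε₀ ε₁ r`, every limit state of every family whose members are eventually `W_b + W` with `W_b` twist-blind and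
`W ∈ ClusterDomainFR ε₀ ε₁ r` obeys `HasAreaLawWith μ χ_N C c`. [folklore] -/
theorem hasAreaLawWith_centreTubeFR [NeZero d] [NeZero N] (hd : 2 ≤ d) {β ε₀ ε₁ : ℝ} {r : ℕ} (h : AreaLawCentreTubeFR N d β ε₀ ε₁ r) :
    ∃ C c : ℝ, 0 < c ∧ ∀ 𝓦 : PerturbationFamily d N,
      (∀ᶠ L : ℕ in atTop, ∃ Wb W : Perturbation d (L + 1) N, IsTwistBlind Wb ∧ W ∈ ClusterDomainFR ε₀ ε₁ r ∧ 𝓦 L = Wb + W) →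
        ∀ μ ∈ perturbedLimitPoints β 𝓦,
          HasAreaLawWith μ (fun g => normalisedCharacter N (fundamentalRep (Fin N) g)) C c := by
  obtain ⟨C, c, hc, hA⟩ := h
  refine ⟨C, c, hc, fun 𝓦 h𝓦 μ hμ => hasAreaLawWith_of_torusBound (β := β)
    (fun L => {W' : Perturbation d (L + 1) N | ∃ Wb W : Perturbation d (L + 1) N,
      IsTwistBlind Wb ∧ W ∈ ClusterDomainFR ε₀ ε₁ r ∧ W' = Wb + W}) (fun L W' hW' R T hR hT hRL hTL => ?_) 𝓦
    (h𝓦.mono fun L hL => hL) hμ⟩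
  obtain ⟨Wb, W, hb, hW, rfl⟩ := hW'
  exact hA (L + 1) Wb W hb hW 0 0 1 R T (fin_zero_ne_one_of_two_le hd) hR hT hRL hTL

/-- **STRING TENSION ON THE TIER-1 BALL AROUND THE CENTRE-BLIND SUBSPACE** (`d ≥ 2`): ONE pair `(C, c)`, `c > 0`, for every limit state of
every eventually-`(W_b + W)` family: `HasAreaLawWith`, `HasAreaLawState`, `σ ≥ c` whenever the string tension exists, `IsConfining` given existence.
Existence of `σ` is NOT asserted. [folklore] -/
theorem stringTension_centreTubeFR [NeZero d] [NeZero N] (hd : 2 ≤ d) {β ε₀ ε₁ : ℝ} {r : ℕ} (h : AreaLawCentreTubeFR N d β ε₀ ε₁ r) :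
    ∃ C c : ℝ, 0 < c ∧ ∀ 𝓦 : PerturbationFamily d N,
      (∀ᶠ L : ℕ in atTop, ∃ Wb W : Perturbation d (L + 1) N, IsTwistBlind Wb ∧ W ∈ ClusterDomainFR ε₀ ε₁ r ∧ 𝓦 L = Wb + W) →
        ∀ μ ∈ perturbedLimitPoints β 𝓦,
          HasAreaLawWith μ (fun g => normalisedCharacter N (fundamentalRep (Fin N) g)) C c ∧
          HasAreaLawState μ (fun g => normalisedCharacter N (fundamentalRep (Fin N) g)) ∧
          (∀ σ : ℝ, HasStringTension μ (fun g => normalisedCharacter N (fundamentalRep (Fin N) g)) σ → c ≤ σ) ∧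
          ((∃ σ : ℝ, HasStringTension μ (fun g => normalisedCharacter N (fundamentalRep (Fin N) g)) σ) →
            IsConfining μ (fun g => normalisedCharacter N (fundamentalRep (Fin N) g))) := by
  obtain ⟨C, c, hc, hA⟩ := hasAreaLawWith_centreTubeFR hd h
  refine ⟨C, c, hc, fun 𝓦 h𝓦 μ hμ => ?_⟩
  have hW := hA 𝓦 h𝓦 μ hμ
  exact ⟨hW, ⟨C, c, hc, hW⟩, fun σ hσ => hW.le_of_hasStringTension hσ,
    fun hσ => HasAreaLawState.isConfining ⟨C, c, hc, hW⟩ hσ⟩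

/-- **SU(2), `d = 4`, range `1`** (`6 β_W + 2449020 ε₀ < 1`): one `c > 0` with `HasAreaLawWith μ χ₂ C c` and `c ≤ suFundStringTension 2 μ` whenever the
string tension exists, for every limit state of every eventually-`(W_b + W)` family, `W_b` twist-blind, `W ∈ ClusterDomainFR ε₀ ε₁ 1`. [folklore] -/
theorem su2_stringTension_centreTubeFR_dim4_range1 {β ε₀ ε₁ : ℝ} (h : 6 * (2 * |β|) + 2449020 * ε₀ < 1) :
    ∃ C c : ℝ, 0 < c ∧ ∀ 𝓦 : PerturbationFamily 4 2,
      (∀ᶠ L : ℕ in atTop, ∃ Wb W : Perturbation 4 (L + 1) 2, IsTwistBlind Wb ∧ W ∈ ClusterDomainFR ε₀ ε₁ 1 ∧ 𝓦 L = Wb + W) →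
        ∀ μ ∈ perturbedLimitPoints β 𝓦,
          HasAreaLawWith μ (fun g => normalisedCharacter 2 (fundamentalRep (Fin 2) g)) C c ∧
          ((∃ σ : ℝ, HasStringTension μ (fun g => normalisedCharacter 2 (fundamentalRep (Fin 2) g)) σ) →
            c ≤ suFundStringTension 2 μ) := by
  obtain ⟨C, c, hc, hA⟩ := hasAreaLawWith_centreTubeFR (N := 2) (by norm_num) (su2_areaLawCentreTubeFR_dim4_range1 ε₁ h)
  refine ⟨C, c, hc, fun 𝓦 h𝓦 μ hμ => ⟨hA 𝓦 h𝓦 μ hμ, fun ⟨σ, hσ⟩ => ?_⟩⟩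
  rw [suFundStringTension_def, hσ.stringTension_eq]
  exact (hA 𝓦 h𝓦 μ hμ).le_of_hasStringTension hσ

end Summit.Ventures.YMGap.RobustBall

end
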